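import Summits.CriticalPhenomena.PercolationContinuityZ3.Theorems.PercNearOneGluingNoHeavyLowerTailSahiGridPatternZeroLocus
import Summits.CriticalPhenomena.PercolationContinuityZ3.Theorems.PercNearOneGluingNoHeavyLowerTailSahiGridPatternDiagCert
import Summits.CriticalPhenomena.PercolationContinuityZ3.Theorems.PercNearOneGluingNoHeavyLowerTailSahiGridPatternFaces

/-!
# `NoHeavyLowerTail` (crux stmt-CriticalPhenomena-4575), Sahi programme P1: **THE FROZEN-BLOCK LEMMA FOR DIAGONAL CERTIFICATES** —
# if `P`, `Q ⊆ U` are supported on disjoint blocks of axes then `sStarD U P Q = 0`, so EVERY diagonal certificate `d` of `U` has `d(P ∩ Q) = λ_U(P ∩ Q)`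

Support file (Sahi cell, seat `prim-sahi-p1`, generation 34; `--supports stmt-CriticalPhenomena-4575`).  Pure proofs, no definitions, no `sorry`, standard axioms.
Vocabulary of `…SahiGridPattern{,SliceForm,RectCert,DiagCert,ZeroLocus,Faces}`.

THE MATHEMATICS (seat memo FROM-prim-sahi-p1-gen34, §3.1).  A diagonal certificate of `U ⊆ [3]^d` is `d` with (T) `d(W) ≤ λ_U(W)` (up-sets `W`) and
(N) `Θ_U(P×Q) ≤ d(P∩Q)` (up-sets `P, Q`), and `sStarD U P Q = λ_U(P∩Q) − Θ_U(P×Q)` (`sStarD_eq_sum_lamU_sub_sum_thetaVal`).  Hence at every pair `(P,Q)` of the ZERO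
LOCUS of the slot `U` the certificate is pinned: `Θ_U(P×Q) ≤ d(P∩Q) ≤ λ_U(P∩Q) = Θ_U(P×Q)`.
* **`sStarD_eq_zero_of_indep_sub`** — if `P` is `I`-measurable, `Q` is `J`-measurable, `I ∩ J = ∅`, and `P ⊆ U`, `Q ⊆ U` (ANY finsets, no monotonicity), then
  `sStarD U P Q = 0`: the saturation hypotheses of `sStarD_eq_zero_of_indepSlots_saturated` (…ZeroLocus) hold because `Q ∩ U = Q` is invariant under changing the
  `I`-coordinates and `P ∩ U = P` under changing the `J`-coordinates; then the slot symmetry of `sStarD` (…Faces).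
* **`diagCert_frozen_of_indep_sub`** — consequently every `d` with (T) and (N) for `U` (up-sets `P, Q`) has `Σ_{q ∈ P∩Q} d(q) = Σ_{q ∈ P∩Q} λ_U(q)`.
USE (memo §3): for a block-OR `U = S ⊕ V` the cylinders over up-sets `S' ⊆ S` and `V' ⊆ V` are such pairs, so every certificate of `S ⊕ V` equals `λ_U` pointwise on
`S × V` — the "frozen block" that dictates the shape of the block-OR certificate vector of `…SahiGridPatternBlockOrT`; for `U = (x∨y)∧(z∨w)` the pair `(x∧z, y∧w)` freezes
the top cube `T×T`.  Nothing here asserts `PatternPos d` for `d ≥ 4`. [this work]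
-/

namespace Summit.CriticalPhenomena.PercolationContinuityZ3.Theorems.SahiGridPattern

open Finset SahiGrid3
open scoped BigOperators

variable {d : ℕ}

/-- **Independent sub-slots annihilate the pattern functional**: `P` `I`-measurable, `Q` `J`-measurable with `I ∩ J = ∅`, `P ⊆ U`, `Q ⊆ U` ⟹ `sStarD U P Q = 0`.
[this work] -/
theorem sStarD_eq_zero_of_indep_sub (I J : Finset (Fin d)) (hIJ : Disjoint I J) {U P Q : Finset (Pd d)}
    (hP : ∀ x y : Pd d, (∀ a ∈ I, x a = y a) → (x ∈ P ↔ y ∈ P))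
    (hQ : ∀ x y : Pd d, (∀ a ∈ J, x a = y a) → (x ∈ Q ↔ y ∈ Q))
    (hPU : P ⊆ U) (hQU : Q ⊆ U) :
    sStarD U P Q = 0 := by
  -- `Q` is invariant under changes confined to `I` (it only reads `J ⊆ Iᶜ`), `P` under changes confined to `J`
  have hQI : ∀ x y : Pd d, (∀ a ∉ I, x a = y a) → (x ∈ Q ↔ y ∈ Q) := fun x y h =>
    hQ x y fun a ha => h a (fun haI => Finset.disjoint_left.1 hIJ haI ha)
  have hPJ : ∀ x y : Pd d, (∀ a ∉ J, x a = y a) → (x ∈ P ↔ y ∈ P) := fun x y h =>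
    hP x y fun a ha => h a (fun haJ => Finset.disjoint_left.1 hIJ ha haJ)
  have hCa : ∀ x y : Pd d, (∀ a ∉ I, x a = y a) → x ∈ Q → (x ∈ U ↔ y ∈ U) := by
    intro x y h hx
    have hy : y ∈ Q := (hQI x y h).1 hx
    exact ⟨fun _ => hQU hy, fun _ => hQU hx⟩
  have hCb : ∀ x y : Pd d, (∀ a ∉ J, x a = y a) → x ∈ P → (x ∈ U ↔ y ∈ U) := by
    intro x y h hx
    have hy : y ∈ P := (hPJ x y h).1 hx
    exact ⟨fun _ => hPU hy, fun _ => hPU hx⟩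
  have h0 : sStarD P Q U = 0 := sStarD_eq_zero_of_indepSlots_saturated I J hIJ hP hQ hCa hCb
  rw [sStarD_swap12 U P Q, sStarD_swap23 P U Q]
  exact h0

/-- **THE FROZEN-BLOCK LEMMA**: every vector `d` with (T) and (N) for `U` satisfies `d(P ∩ Q) = λ_U(P ∩ Q)` for all independent up-sets `P, Q ⊆ U`
(`P` `I`-measurable, `Q` `J`-measurable, `I ∩ J = ∅`). [this work] -/
theorem diagCert_frozen_of_indep_sub (I J : Finset (Fin d)) (hIJ : Disjoint I J) {U P Q : Finset (Pd d)}
    (hP : ∀ x y : Pd d, (∀ a ∈ I, x a = y a) → (x ∈ P ↔ y ∈ P))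
    (hQ : ∀ x y : Pd d, (∀ a ∈ J, x a = y a) → (x ∈ Q ↔ y ∈ Q))
    (hPU : P ⊆ U) (hQU : Q ⊆ U)
    (hPup : IsUpperSet (P : Set (Pd d))) (hQup : IsUpperSet (Q : Set (Pd d)))
    (dU : Pd d → ℤ)
    (hT : ∀ W : Finset (Pd d), IsUpperSet (W : Set (Pd d)) → (∑ q ∈ W, dU q) ≤ ∑ q ∈ W, lamU U q)
    (hN : ∀ A A' : Finset (Pd d), IsUpperSet (A : Set (Pd d)) → IsUpperSet (A' : Set (Pd d)) →
      (∑ q ∈ A, ∑ r ∈ A', thetaVal U q r) ≤ ∑ q ∈ A ∩ A', dU q) :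
    (∑ q ∈ P ∩ Q, dU q) = ∑ q ∈ P ∩ Q, lamU U q := by
  have h0 := sStarD_eq_zero_of_indep_sub I J hIJ hP hQ hPU hQU
  rw [sStarD_eq_sum_lamU_sub_sum_thetaVal] at h0
  have h1 := hT (P ∩ Q) (isUpperSet_inter_coe hPup hQup)
  have h2 := hN P Q hPup hQup
  linarith

/-- Cylinder form of block measurability: a set given by a condition on the `I`-coordinates only is `I`-measurable.  (Convenience restatement used to feed
cylinders over sub-up-sets of the blocks of a block-OR into the frozen-block lemma.) [this work] -/
theorem measurable_of_forall_iff (I : Finset (Fin d)) {P : Finset (Pd d)} (φ : Pd d → Prop)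
    (hφ : ∀ x y : Pd d, (∀ a ∈ I, x a = y a) → (φ x ↔ φ y)) (hP : ∀ x, x ∈ P ↔ φ x) :
    ∀ x y : Pd d, (∀ a ∈ I, x a = y a) → (x ∈ P ↔ y ∈ P) := by
  intro x y h
  rw [hP x, hP y]
  exact hφ x y h

end Summit.CriticalPhenomena.PercolationContinuityZ3.Theorems.SahiGridPattern
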